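import Summits.QuantumFields.BalabanUV.Beta.GAN24.StepCovarianceSandwich
import Summits.QuantumFields.BalabanUV.Beta.GAN24.RelInvWardPairing
import Summits.QuantumFields.BalabanUV.Beta.GAN24.TaylorBlockSum

/-!
# `BalabanUV.Beta.GAN24.StepCovarianceSandwichApply` — binder row G-an2-4 ∕ (CONV-C), W-slot (α-0), ROW (C) AT LEVELS `j ≥ 1`, letter L4′ of the (γ) hand's memo
# `HOME/b2b-balaban-gan24-formalise-leaf-06/g51/C-LEVELS-GE1.md` §13–§16: **THE TELESCOPING ON DATA — for a bounded field-leg form `h` with zero `Lc`-block contour sums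
# (`contourSum Lc h = 0`), `E2_{j+1} (G_{j+1} (E2_{j+1} h)) = wVH_{j+1}⁻¹ · E2_{j+1} h`** (absolutely convergent iterated applications; every `j`, every in-block root, every `d`,
# `Lc ≥ 1`) — the consumer form of `StepCovarianceSandwich.sandwich_inl_inl` for the (C) words, whose gauge data `λ_μ·𝟙f_α` (`μ ≠ α`) have zero block contour sums
# (G-an2-4 CRUX TEAM (2), seat `b2b-balaban-gan24-formalise-leaf-06` = the (γ) hand, gen 52; journal INTENT I-leaf06-g52-2)

NOT IN PRINT; OUR BOOKKEEPING ([folklore] Fubini bookkeeping BY NAME: the entrywise sandwich `StepCovarianceSandwich.sandwich_inl_inl` (this lineage, L4), the adjointness of the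
contour-sum adjoint against bounded data `GAN24.RelInvWardPairing.tsum_mul_contourSumAdj_bdd` (this lineage, gen 46), the decay of `E2` ∕ `coDressKBmAt (KInvStep)` and
`ExpKernelCalculus.summable_exp_shift` ∕ `tsum_exp_shift`; 0 `def`, 0 cited fact, 0 `def … : Prop`, 0 sorry).
HONEST FRAMING (cell contract, verbatim): «discharging `BetaPertH` makes Bałaban's UV stability UNCONDITIONAL — a real constructive-QFT result; it is NOT the continuum
limit and NOT the Clay problem.»  HONEST DEPENDENCY (verbatim): «continuum YM on T⁴ ⇐ BetaPertH ∧ nine spine estimates (0/9 proved); BetaPertH ⇐ (D1) ∧ (D4) ∧ CAP+tail;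
G-an2-4 gates asym, D1 and NE2/3/4.»

WHY.  In leaf-04's two-face currency (`DressedSourceZeroModeWords.zmode_dressedSource_inl_inl`, every `j`) the direct exchange word of `zmode Lc b̃_j` resums, by the cubic background
letter L1 (`CubicBackgroundGaugeLetter`), `E2 ĉ = 0` and `E2 (dψ) = 0`, to a cell pairing `⟨E2_j p, X̃_j (E2_j q)⟩` with `p = λ_μ·𝟙f_α`, `q = λ_ν·𝟙f_β` (sawtooth times exit-face
profile) plus tower cross terms; for `ν ≠ β` the datum `q` has ZERO block contour sums (the sawtooth `λ_ν` has zero block mean and is constant along `β`-contours), so §3 evaluates the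
middle: `E2 G E2 q = wVH⁻¹·E2 q` — the engine's telescoping constant `κ_j = ((Lc^j)^{d+2})⁻²` (R-leaf06-g51-2), now at every level in the kernel.
* §1 generic Fubini for decaying kernels against bounded field-leg data: `summable_apply_bdd`, `abs_apply_bdd_le`, **`tsum_comp_apply_bdd`** (`(A ∘ T)·h = A·(T·h)`).
* §2 the tent term against data: **`tsum_tent_apply_eq`** (adjointness in the data variable) and `tsum_tent_apply_eq_zero_of_contourSum` (it vanishes when `contourSum Lc h = 0`).
* §3 **`tsum_sandwich_apply_of_contourSum_eq_zero`** (the sandwich kernel applied to `h`) and **`tsum_E2_G_E2_apply_of_contourSum_eq_zero`** (the iterated-application form of the title).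
Asserts NO value of Bałaban's tables; discharges NOTHING of (C) ∕ (C)sym ∕ (Q-L) ∕ «T2Shape» ∕ «T2Drift» ∕ (hW, hWall); NEVER «G-an2-4 closed» as (CONV-C); NOT D1, NOT
`BetaPertH`, NOT continuum, NOT Clay.  2026-08-23; no existing file touched.
-/

noncomputable section

open Finset
open scoped BigOperators
open Literature.MathematicalPhysics.QuantumFieldTheory
open Literature.MathematicalPhysics.QuantumFieldTheory.Balaban1983to89
open Literature.MathematicalPhysics.QuantumFieldTheory.Balaban1983to89.Beta
open B12Sec2to5 (l1 l1_nonneg)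
open ExpKernelCalculus (Site MKer Decays comp Zl Zl_nonneg summable_exp_shift summable_exp_shift' tsum_exp_shift)
open AffineAveraging (Form1 box toSite contourSum)
open AffineReproduction (contourSumAdj)
open OneStepResolventKernel (Fib)
open OneStepKernelFamily (KInvStep decays_KInvStep)
open BalabanStepJetsSucc (E2 wVH decays_E2)
open Summit.QuantumFields.BalabanUV.Beta.TameKernelCalculus
open Summit.QuantumFields.BalabanUV.Beta.AxialDressingRooted (coDressKBmAt decays_coDressKBmAt_KInvStep one_le_of_neZero)
open Summit.QuantumFields.BalabanUV.Beta.BorderedHessian (E2_inl_inr E2_inr)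
open Summit.QuantumFields.BalabanUV.Beta.GAN24.RelInvWardPairing (tsum_mul_contourSumAdj_bdd)
open Summit.QuantumFields.BalabanUV.Beta.GAN24.StepCovarianceSandwich (sandwich_inl_inl spr_E2)

namespace Summit.QuantumFields.BalabanUV.Beta.GAN24.StepCovarianceSandwichApply

variable {d : ℕ}

/-! ## §1 Decaying kernels against bounded field-leg data -/

section Apply

variable {K A T : MKer (d + 1) (Fib d)} {C δ CA δA CT δT B : ℝ} {h : Fin (d + 1) → Site (d + 1) → ℝ}

/-- [folklore] A row of a decaying kernel against bounded field-leg data is summable. -/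
theorem summable_apply_bdd (hK : Decays K C δ) (hδ : 0 < δ) (hh : ∀ b z, |h b z| ≤ B) (x : Site (d + 1)) (a : Fib d) :
    Summable fun z => ∑ b : Fin (d + 1), K x z a (Sum.inl b) * h b z := by
  have hC : 0 ≤ C := hK.nonneg (Sum.inl 0)
  have hB : 0 ≤ B := (abs_nonneg _).trans (hh 0 0)
  refine Summable.of_norm_bounded ((summable_exp_shift hδ x).mul_left (((d : ℝ) + 1) * (C * B))) fun z => ?_
  rw [Real.norm_eq_abs]
  refine (Finset.abs_sum_le_sum_abs _ _).trans ?_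
  have hterm : ∀ b : Fin (d + 1), |K x z a (Sum.inl b) * h b z| ≤ C * B * Real.exp (-δ * l1 (x - z)) := by
    intro b
    rw [abs_mul]
    calc |K x z a (Sum.inl b)| * |h b z| ≤ (C * Real.exp (-δ * l1 (x - z))) * B :=
          mul_le_mul (hK x z a (Sum.inl b)) (hh b z) (abs_nonneg _) (by positivity)
      _ = _ := by ring
  refine (Finset.sum_le_sum fun b _ => hterm b).trans (le_of_eq ?_)
  rw [Finset.sum_const, Finset.card_univ, Fintype.card_fin, nsmul_eq_mul]
  push_cast
  ring

/-- [folklore] … and the application is bounded: `|Σ'_z Σ_b K x z a (inl b)·h b z| ≤ (d+1)·C·B·Zl δ`. -/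
theorem abs_apply_bdd_le (hK : Decays K C δ) (hδ : 0 < δ) (hh : ∀ b z, |h b z| ≤ B) (x : Site (d + 1)) (a : Fib d) :
    |∑' z, ∑ b : Fin (d + 1), K x z a (Sum.inl b) * h b z| ≤ ((d : ℝ) + 1) * (C * B) * Zl (d + 1) δ := by
  have hC : 0 ≤ C := hK.nonneg (Sum.inl 0)
  have hB : 0 ≤ B := (abs_nonneg _).trans (hh 0 0)
  have hmaj := (summable_exp_shift hδ x).mul_left (((d : ℝ) + 1) * (C * B))
  have hb := tsum_of_norm_bounded hmaj.hasSum (f := fun z => ∑ b : Fin (d + 1), K x z a (Sum.inl b) * h b z) fun z => ?_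
  · rw [Real.norm_eq_abs] at hb
    refine hb.trans (le_of_eq ?_)
    rw [tsum_mul_left, tsum_exp_shift]
  · rw [Real.norm_eq_abs]
    refine (Finset.abs_sum_le_sum_abs _ _).trans ?_
    have hterm : ∀ b : Fin (d + 1), |K x z a (Sum.inl b) * h b z| ≤ C * B * Real.exp (-δ * l1 (x - z)) := by
      intro b
      rw [abs_mul]
      calc |K x z a (Sum.inl b)| * |h b z| ≤ (C * Real.exp (-δ * l1 (x - z))) * B :=
            mul_le_mul (hK x z a (Sum.inl b)) (hh b z) (abs_nonneg _) (by positivity)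
        _ = _ := by ring
    refine (Finset.sum_le_sum fun b _ => hterm b).trans (le_of_eq ?_)
    rw [Finset.sum_const, Finset.card_univ, Fintype.card_fin, nsmul_eq_mul]
    push_cast
    ring

/-- [folklore] **ONE FUBINI: `(A ∘ T)·h = A·(T·h)` on bounded field-leg data** (both kernels decaying at positive rates):
`Σ'_z Σ_b (A ∘ T)(x,z)(a, inl b)·h b z = Σ'_y Σ_f A(x,y)(a,f) · Σ'_z Σ_b T(y,z)(f, inl b)·h b z`. -/
theorem tsum_comp_apply_bdd (hA : Decays A CA δA) (hδA : 0 < δA) (hT : Decays T CT δT) (hδT : 0 < δT) (hh : ∀ b z, |h b z| ≤ B) (x : Site (d + 1))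
    (a : Fib d) :
    (∑' z, ∑ b : Fin (d + 1), comp A T x z a (Sum.inl b) * h b z) = ∑' y, ∑ f : Fib d, A x y a f * ∑' z, ∑ b : Fin (d + 1), T y z f (Sum.inl b) * h b z := by
  classical
  have hCA : 0 ≤ CA := hA.nonneg (Sum.inl 0)
  have hCT : 0 ≤ CT := hT.nonneg (Sum.inl 0)
  have hB : 0 ≤ B := (abs_nonneg _).trans (hh 0 0)
  set M : ℝ := (Fintype.card (Fib d) : ℝ) * (((d : ℝ) + 1) * (CA * CT * B)) with hM
  -- the double family `(y, z) ↦ Σ_f Σ_b A x y a f · T y z f (inl b) · h b z` and its product majorant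
  set F : Site (d + 1) × Site (d + 1) → ℝ := fun q => ∑ f : Fib d, ∑ b : Fin (d + 1), A x q.1 a f * (T q.1 q.2 f (Sum.inl b) * h b q.2) with hF
  have hin : ∀ y : Site (d + 1), HasSum (fun z : Site (d + 1) => (M * Real.exp (-δA * l1 (x - y))) * Real.exp (-δT * l1 (y - z)))
      ((M * Real.exp (-δA * l1 (x - y))) * Zl (d + 1) δT) := by
    intro y
    have h0 := (summable_exp_shift hδT y).hasSum
    rw [tsum_exp_shift y] at h0
    exact h0.mul_left _
  have hM0 : Summable fun q : Site (d + 1) × Site (d + 1) => (M * Real.exp (-δA * l1 (x - q.1))) * Real.exp (-δT * l1 (q.1 - q.2)) := by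
    refine (summable_prod_of_nonneg fun q => by positivity).2 ⟨fun y => (hin y).summable, ?_⟩
    exact (((summable_exp_shift hδA x).mul_left M).mul_right (Zl (d + 1) δT)).congr fun y => ((hin y).tsum_eq).symm
  have hFle : ∀ q : Site (d + 1) × Site (d + 1), |F q| ≤ (M * Real.exp (-δA * l1 (x - q.1))) * Real.exp (-δT * l1 (q.1 - q.2)) := by
    intro q
    rw [hF]
    refine (Finset.abs_sum_le_sum_abs _ _).trans ?_
    have hterm : ∀ f : Fib d, |∑ b : Fin (d + 1), A x q.1 a f * (T q.1 q.2 f (Sum.inl b) * h b q.2)| ≤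
        ((d : ℝ) + 1) * (CA * CT * B) * Real.exp (-δA * l1 (x - q.1)) * Real.exp (-δT * l1 (q.1 - q.2)) := by
      intro f
      refine (Finset.abs_sum_le_sum_abs _ _).trans ?_
      have hb : ∀ b : Fin (d + 1), |A x q.1 a f * (T q.1 q.2 f (Sum.inl b) * h b q.2)| ≤
          (CA * CT * B) * Real.exp (-δA * l1 (x - q.1)) * Real.exp (-δT * l1 (q.1 - q.2)) := by
        intro b
        rw [abs_mul, abs_mul]
        calc |A x q.1 a f| * (|T q.1 q.2 f (Sum.inl b)| * |h b q.2|)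
            ≤ (CA * Real.exp (-δA * l1 (x - q.1))) * ((CT * Real.exp (-δT * l1 (q.1 - q.2))) * B) :=
              mul_le_mul (hA x q.1 a f) (mul_le_mul (hT q.1 q.2 f (Sum.inl b)) (hh b q.2) (abs_nonneg _) (by positivity)) (by positivity)
                (by positivity)
          _ = _ := by ring
      refine (Finset.sum_le_sum fun b _ => hb b).trans (le_of_eq ?_)
      rw [Finset.sum_const, Finset.card_univ, Fintype.card_fin, nsmul_eq_mul]
      push_cast
      ring
    refine (Finset.sum_le_sum fun f _ => hterm f).trans (le_of_eq ?_)
    rw [Finset.sum_const, Finset.card_univ, nsmul_eq_mul, hM]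
    ring
  have hFs : Summable F := Summable.of_norm_bounded hM0 fun q => by rw [Real.norm_eq_abs]; exact hFle q
  have hFs' : Summable fun q : Site (d + 1) × Site (d + 1) => F (q.2, q.1) := hFs.prod_symm
  -- left side = the `(z, y)` iterated sum of `F`
  have hL : (∑' z, ∑ b : Fin (d + 1), comp A T x z a (Sum.inl b) * h b z) = ∑' z, ∑' y, F (y, z) := by
    refine tsum_congr fun z => ?_
    have hs : ∀ b : Fin (d + 1), Summable fun y => ∑ f : Fib d, A x y a f * (T y z f (Sum.inl b) * h b z) := by
      intro b
      refine summable_sum fun f _ => ?_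
      refine Summable.of_norm_bounded ((summable_exp_shift hδA x).mul_left (CA * (CT * |h b z|))) fun y => ?_
      rw [Real.norm_eq_abs, abs_mul, abs_mul]
      have hexp : Real.exp (-δT * l1 (y - z)) ≤ 1 := by
        rw [Real.exp_le_one_iff, neg_mul]
        exact neg_nonpos.mpr (mul_nonneg hδT.le (l1_nonneg _))
      have hT1 : |T y z f (Sum.inl b)| ≤ CT := (hT y z f (Sum.inl b)).trans (mul_le_of_le_one_right hCT hexp)
      calc |A x y a f| * (|T y z f (Sum.inl b)| * |h b z|) ≤ (CA * Real.exp (-δA * l1 (x - y))) * (CT * |h b z|) :=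
            mul_le_mul (hA x y a f) (mul_le_mul_of_nonneg_right hT1 (abs_nonneg _)) (by positivity) (by positivity)
        _ = _ := by ring
    have e1 : ∀ b : Fin (d + 1), comp A T x z a (Sum.inl b) * h b z = ∑' y, ∑ f : Fib d, A x y a f * (T y z f (Sum.inl b) * h b z) := by
      intro b
      unfold ExpKernelCalculus.comp
      rw [← tsum_mul_right]
      refine tsum_congr fun y => ?_
      rw [Finset.sum_mul]
      exact Finset.sum_congr rfl fun f _ => by ring
    rw [Finset.sum_congr rfl fun b _ => e1 b, ← Summable.tsum_finsetSum fun b _ => hs b]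
    refine tsum_congr fun y => ?_
    simp only [hF]
    exact Finset.sum_comm
  -- right side = the `(y, z)` iterated sum of `F`
  have hR : (∑' y, ∑ f : Fib d, A x y a f * ∑' z, ∑ b : Fin (d + 1), T y z f (Sum.inl b) * h b z) = ∑' y, ∑' z, F (y, z) := by
    refine tsum_congr fun y => ?_
    have hs : ∀ f : Fib d, Summable fun z => A x y a f * ∑ b : Fin (d + 1), T y z f (Sum.inl b) * h b z :=
      fun f => (summable_apply_bdd hT hδT hh y f).mul_left (A x y a f)
    rw [show (∑ f : Fib d, A x y a f * ∑' z, ∑ b : Fin (d + 1), T y z f (Sum.inl b) * h b z) =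
        ∑ f : Fib d, ∑' z, A x y a f * ∑ b : Fin (d + 1), T y z f (Sum.inl b) * h b z from
      Finset.sum_congr rfl fun f _ => tsum_mul_left.symm, ← Summable.tsum_finsetSum fun f _ => hs f]
    refine tsum_congr fun z => ?_
    simp only [hF, Finset.mul_sum]
  rw [hL, hR]
  calc (∑' z, ∑' y, F (y, z)) = ∑' q : Site (d + 1) × Site (d + 1), F (q.2, q.1) := hFs'.tsum_prod.symm
    _ = ∑' q : Site (d + 1) × Site (d + 1), F q :=
        (Equiv.prodComm (Site (d + 1)) (Site (d + 1))).tsum_eq (fun q : Site (d + 1) × Site (d + 1) => F q)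
    _ = _ := hFs.tsum_prod

end Apply

/-! ## §2 The tent term against data -/

section Tent

variable {Lc : ℕ} [NeZero Lc]

/-- [folklore] A pulled-back, shifted column of a decaying kernel is summable: `z ↦ A (quo N (z − c)) y′ a b`. -/
theorem summable_col_quo_shift {A : MKer (d + 1) (Fib d)} {C δ : ℝ} (hA : Decays A C δ) (hδ : 0 < δ) (N : ℕ) [NeZero N]
    (c y' : Site (d + 1)) (a b : Fib d) : Summable fun z : Site (d + 1) => A (LatticeForm.quo N (z - c)) y' a b := by
  have h := TaylorBlockSum.summable_comp_quo (N := N) (AxialDressing.summable_col_of_decays hA hδ y' a b)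
  exact (Equiv.subRight c).summable_iff.2 h

/-- [folklore] The inner tent column `z ↦ 𝒬ᵀ_{Lc}[κ′,y″ ↦ E2_{j′}(y″,y′)_{κ′ m}](b, z)` against bounded data is summable. -/
theorem summable_tentCol_mul (j' : ℕ) {h : Fin (d + 1) → Site (d + 1) → ℝ} {B : ℝ} (hh : ∀ b z, |h b z| ≤ B) (y' : Site (d + 1))
    (m : Fin (d + 1)) :
    Summable fun z : Site (d + 1) => ∑ b : Fin (d + 1),
      contourSumAdj Lc (fun κ' y'' => E2 d Lc j' y'' y' (Sum.inl κ') (Sum.inl m)) b z * h b z := by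
  obtain ⟨δ, C, hδ, -, hE⟩ := decays_E2 (d := d) (Lc := Lc) j'
  refine summable_sum fun b _ => ?_
  refine KKTFluctuationEnergy.summable_mul_of_bdd' ?_ (hh b)
  unfold AffineReproduction.contourSumAdj
  refine summable_sum fun s _ => ?_
  exact summable_col_quo_shift hE hδ Lc _ y' (Sum.inl b) (Sum.inl m)

/-- [folklore] **THE TENT TERM AGAINST BOUNDED DATA** (adjointness in the data variable, under the finite outer contour-sum adjoint):
`Σ'_z Σ_b 𝒬ᵀ[m,y′ ↦ 𝒬ᵀ[κ′,y″ ↦ E2_{j′}(y″,y′)_{κ′m}](b,z)](a,x)·h b z = 𝒬ᵀ[m,y′ ↦ Σ'_{y″} Σ_{κ′} E2_{j′}(y″,y′)_{κ′m}·(𝒬_{Lc} h)(κ′,y″)](a,x)`. -/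
theorem tsum_tent_apply_eq (j' : ℕ) {h : Fin (d + 1) → Site (d + 1) → ℝ} {B : ℝ} (hh : ∀ b z, |h b z| ≤ B) (x : Site (d + 1)) (a : Fin (d + 1)) :
    (∑' z, ∑ b : Fin (d + 1),
        contourSumAdj Lc (fun m y' => contourSumAdj Lc (fun κ' y'' => E2 d Lc j' y'' y' (Sum.inl κ') (Sum.inl m)) b z) a x * h b z) =
      contourSumAdj Lc (fun m y' => ∑' y'', ∑ κ' : Fin (d + 1), E2 d Lc j' y'' y' (Sum.inl κ') (Sum.inl m) * contourSum Lc h κ' y'') a x := by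
  obtain ⟨δ, C, hδ, -, hE⟩ := decays_E2 (d := d) (Lc := Lc) j'
  rw [KKTFluctuationEnergy.contourSumAdj_eq]
  -- the outer contour-sum adjoint is a finite sum of evaluations: pull it out of the data pairing
  have e1 : ∀ z, (∑ b : Fin (d + 1),
      contourSumAdj Lc (fun m y' => contourSumAdj Lc (fun κ' y'' => E2 d Lc j' y'' y' (Sum.inl κ') (Sum.inl m)) b z) a x * h b z) =
      ∑ s ∈ Finset.range Lc, ∑ b : Fin (d + 1),
        contourSumAdj Lc (fun κ' y'' => E2 d Lc j' y'' (LatticeForm.quo Lc (x - (s : ℤ) • AffineAveraging.unitVec a)) (Sum.inl κ') (Sum.inl a)) b z *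
          h b z := by
    intro z
    rw [Finset.sum_comm]
    refine Finset.sum_congr rfl fun b _ => ?_
    rw [KKTFluctuationEnergy.contourSumAdj_eq, Finset.sum_mul]
  rw [tsum_congr e1, Summable.tsum_finsetSum (fun s _ => summable_tentCol_mul j' hh _ a)]
  refine Finset.sum_congr rfl fun s _ => ?_
  have e2 : ∀ z, (∑ b : Fin (d + 1),
      contourSumAdj Lc (fun κ' y'' => E2 d Lc j' y'' (LatticeForm.quo Lc (x - (s : ℤ) • AffineAveraging.unitVec a)) (Sum.inl κ') (Sum.inl a)) b z * h b z) =
      ∑ b : Fin (d + 1), h b z *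
        contourSumAdj Lc (fun κ' y'' => E2 d Lc j' y'' (LatticeForm.quo Lc (x - (s : ℤ) • AffineAveraging.unitVec a)) (Sum.inl κ') (Sum.inl a)) b z :=
    fun z => Finset.sum_congr rfl fun b _ => mul_comm _ _
  rw [tsum_congr e2]
  exact tsum_mul_contourSumAdj_bdd hh fun κ' =>
    (TaylorBlockSum.summable_comp_quo (N := Lc) (AxialDressing.summable_col_of_decays hE hδ _ (Sum.inl κ') (Sum.inl a))).abs

/-- [folklore] … hence **THE TENT TERM DROPS ON DATA WITH ZERO BLOCK CONTOUR SUMS**. -/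
theorem tsum_tent_apply_eq_zero_of_contourSum (j' : ℕ) {h : Fin (d + 1) → Site (d + 1) → ℝ} {B : ℝ} (hh : ∀ b z, |h b z| ≤ B)
    (h0 : ∀ κ y, contourSum Lc h κ y = 0) (x : Site (d + 1)) (a : Fin (d + 1)) :
    (∑' z, ∑ b : Fin (d + 1),
        contourSumAdj Lc (fun m y' => contourSumAdj Lc (fun κ' y'' => E2 d Lc j' y'' y' (Sum.inl κ') (Sum.inl m)) b z) a x * h b z) = 0 := by
  rw [tsum_tent_apply_eq j' hh x a]
  have hz : (fun (m : Fin (d + 1)) (y' : Site (d + 1)) => ∑' y'', ∑ κ' : Fin (d + 1), E2 d Lc j' y'' y' (Sum.inl κ') (Sum.inl m) * contourSum Lc h κ' y'') =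
      fun _ _ => 0 := by
    funext m y'
    simp only [h0, mul_zero, Finset.sum_const_zero, tsum_zero]
  rw [hz, KKTFluctuationEnergy.contourSumAdj_eq]
  exact Finset.sum_const_zero

end Tent

/-! ## §3 The sandwich against data with zero block contour sums -/

section Sandwich

variable {Lc : ℕ} [NeZero Lc]

/-- [folklore] **THE SANDWICH KERNEL AGAINST DATA WITH ZERO BLOCK CONTOUR SUMS**: for bounded field-leg data `h` with `contourSum Lc h = 0`,
`Σ'_z Σ_b (E2_{j+1} ∘ G_{j+1} ∘ E2_{j+1})(x,z)_{inl a, inl b}·h b z = wVH_{j+1}⁻¹ · Σ'_z Σ_b E2_{j+1}(x,z)_{ab}·h b z` (in-block root `toSite r`). -/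
theorem tsum_sandwich_apply_of_contourSum_eq_zero {r : Fin (d + 1) → ℕ} (hr : r ∈ box (d + 1) Lc) (j : ℕ)
    {h : Fin (d + 1) → Site (d + 1) → ℝ} {B : ℝ} (hh : ∀ b z, |h b z| ≤ B) (h0 : ∀ κ y, contourSum Lc h κ y = 0) (x : Site (d + 1)) (a : Fin (d + 1)) :
    (∑' z, ∑ b : Fin (d + 1),
        comp (comp (E2 d Lc (j + 1)) (coDressKBmAt (toSite r) Lc (KInvStep (d := d) Lc (j + 1)))) (E2 d Lc (j + 1)) x z (Sum.inl a) (Sum.inl b) *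
          h b z) =
      (wVH d Lc (j + 1))⁻¹ * ∑' z, ∑ b : Fin (d + 1), E2 d Lc (j + 1) x z (Sum.inl a) (Sum.inl b) * h b z := by
  obtain ⟨δ, C, hδ, -, hE⟩ := decays_E2 (d := d) (Lc := Lc) (j + 1)
  have e : ∀ z, (∑ b : Fin (d + 1),
      comp (comp (E2 d Lc (j + 1)) (coDressKBmAt (toSite r) Lc (KInvStep (d := d) Lc (j + 1)))) (E2 d Lc (j + 1)) x z (Sum.inl a) (Sum.inl b) *
        h b z) =
      (wVH d Lc (j + 1))⁻¹ * (∑ b : Fin (d + 1), E2 d Lc (j + 1) x z (Sum.inl a) (Sum.inl b) * h b z) -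
        (wVH d Lc (j + 1))⁻¹ * (∑ b : Fin (d + 1),
          contourSumAdj Lc (fun m y' => contourSumAdj Lc (fun κ' y'' => E2 d Lc (j + 2) y'' y' (Sum.inl κ') (Sum.inl m)) b z) a x * h b z) := by
    intro z
    rw [Finset.mul_sum, Finset.mul_sum, ← Finset.sum_sub_distrib]
    refine Finset.sum_congr rfl fun b _ => ?_
    rw [sandwich_inl_inl hr j x z a b]
    ring
  rw [tsum_congr e, ((summable_apply_bdd hE hδ hh x (Sum.inl a)).mul_left _).tsum_sub ((summable_tentCol_mul' hh).mul_left _), tsum_mul_left,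
    tsum_mul_left, tsum_tent_apply_eq_zero_of_contourSum (j + 2) hh h0 x a, mul_zero, sub_zero]
where
  /-- the outer tent row against bounded data is summable (finite sum of the inner columns) -/
  summable_tentCol_mul' {h : Fin (d + 1) → Site (d + 1) → ℝ} {B : ℝ} (hh : ∀ b z, |h b z| ≤ B) :
      Summable fun z : Site (d + 1) => ∑ b : Fin (d + 1),
        contourSumAdj Lc (fun m y' => contourSumAdj Lc (fun κ' y'' => E2 d Lc (j + 2) y'' y' (Sum.inl κ') (Sum.inl m)) b z) a x * h b z := by
    have e1 : ∀ z, (∑ b : Fin (d + 1),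
        contourSumAdj Lc (fun m y' => contourSumAdj Lc (fun κ' y'' => E2 d Lc (j + 2) y'' y' (Sum.inl κ') (Sum.inl m)) b z) a x * h b z) =
        ∑ s ∈ Finset.range Lc, ∑ b : Fin (d + 1),
          contourSumAdj Lc (fun κ' y'' => E2 d Lc (j + 2) y'' (LatticeForm.quo Lc (x - (s : ℤ) • AffineAveraging.unitVec a)) (Sum.inl κ') (Sum.inl a)) b z *
            h b z := by
      intro z
      rw [Finset.sum_comm]
      refine Finset.sum_congr rfl fun b _ => ?_
      rw [KKTFluctuationEnergy.contourSumAdj_eq, Finset.sum_mul]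
    simp_rw [e1]
    exact summable_sum fun s _ => summable_tentCol_mul (j + 2) hh _ a

/-- [folklore] **THE TELESCOPING ON DATA** (the statement in the title, iterated-application form): for bounded field-leg data `h` with `contourSum Lc h = 0`,
`Σ'_y Σ_l E2_{j+1}(x,y)_{al} · Σ'_w Σ_{l′} G_{j+1}(y,w)_{ll′} · Σ'_z Σ_b E2_{j+1}(w,z)_{l′b}·h b z = wVH_{j+1}⁻¹ · Σ'_z Σ_b E2_{j+1}(x,z)_{ab}·h b z`. -/
theorem tsum_E2_G_E2_apply_of_contourSum_eq_zero {r : Fin (d + 1) → ℕ} (hr : r ∈ box (d + 1) Lc) (j : ℕ)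
    {h : Fin (d + 1) → Site (d + 1) → ℝ} {B : ℝ} (hh : ∀ b z, |h b z| ≤ B) (h0 : ∀ κ y, contourSum Lc h κ y = 0) (x : Site (d + 1)) (a : Fin (d + 1)) :
    (∑' y, ∑ l : Fin (d + 1), E2 d Lc (j + 1) x y (Sum.inl a) (Sum.inl l) *
        ∑' w, ∑ l' : Fin (d + 1), coDressKBmAt (toSite r) Lc (KInvStep (d := d) Lc (j + 1)) y w (Sum.inl l) (Sum.inl l') *
          ∑' z, ∑ b : Fin (d + 1), E2 d Lc (j + 1) w z (Sum.inl l') (Sum.inl b) * h b z) =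
      (wVH d Lc (j + 1))⁻¹ * ∑' z, ∑ b : Fin (d + 1), E2 d Lc (j + 1) x z (Sum.inl a) (Sum.inl b) * h b z := by
  set E : MKer (d + 1) (Fib d) := E2 d Lc (j + 1) with hEdef
  set G : MKer (d + 1) (Fib d) := coDressKBmAt (toSite r) Lc (KInvStep (d := d) Lc (j + 1)) with hGdef
  obtain ⟨δE, CE, hδE, hCE, hE⟩ := decays_E2 (d := d) (Lc := Lc) (j + 1)
  obtain ⟨δG, CG, hδG, hCG, hG⟩ := decays_coDressKBmAt_KInvStep (d := d) hr (j + 1)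
  rw [← hEdef] at hE
  rw [← hGdef] at hG
  -- common rate and the decay of `E ∘ G`
  set δ₀ : ℝ := min δE δG with hδ₀
  have hδ₀0 : 0 < δ₀ := lt_min hδE hδG
  have hE' : Decays E (|CE|) δ₀ := decays_of_le hE (min_le_left _ _)
  have hG' : Decays G (|CG|) δ₀ := decays_of_le hG (min_le_right _ _)
  have hEG : Decays (comp E G) _ (δ₀ / 2) := BalabanStepJetsSucc.decays_comp hE' hG' (half_pos hδ₀0).le (half_lt_self hδ₀0)
  -- the data `D := E·h` is bounded
  set D : Fin (d + 1) → Site (d + 1) → ℝ := fun l' w => ∑' z, ∑ b : Fin (d + 1), E w z (Sum.inl l') (Sum.inl b) * h b z with hD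
  have hDb : ∀ l' w, |D l' w| ≤ ((d : ℝ) + 1) * (CE * B) * Zl (d + 1) δE := fun l' w => abs_apply_bdd_le hE hδE hh w (Sum.inl l')
  -- start from the sandwich kernel against `h`
  rw [← tsum_sandwich_apply_of_contourSum_eq_zero hr j hh h0 x a, ← hEdef, ← hGdef]
  -- Fubini 1: `((E∘G)∘E)·h = (E∘G)·(E·h)`
  rw [tsum_comp_apply_bdd hEG (half_pos hδ₀0) hE hδE hh x (Sum.inl a)]
  -- only field fibres survive in the middle (`E` has no multiplier rows)
  have e1 : ∀ w, (∑ g : Fib d, comp E G x w (Sum.inl a) g * ∑' z, ∑ b : Fin (d + 1), E w z g (Sum.inl b) * h b z) =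
      ∑ l' : Fin (d + 1), comp E G x w (Sum.inl a) (Sum.inl l') * D l' w := by
    intro w
    rw [Fintype.sum_sum_type]
    simp only [hD, hEdef, E2_inr, zero_mul, Finset.sum_const_zero, tsum_zero, mul_zero, add_zero]
  rw [tsum_congr e1]
  -- Fubini 2: `(E∘G)·D = E·(G·D)`
  rw [tsum_comp_apply_bdd hE hδE hG hδG hDb x (Sum.inl a)]
  refine tsum_congr fun y => ?_
  rw [Fintype.sum_sum_type]
  simp only [hD, hEdef, E2_inl_inr, zero_mul, Finset.sum_const_zero, add_zero]

end Sandwich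

end Summit.QuantumFields.BalabanUV.Beta.GAN24.StepCovarianceSandwichApply

end
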